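import Mathlib
import HarnessLib
import HarnessLib.Audit
import Summits.SmoothPoincare4.Statement
import Literature.Geometry.Lorentzian.LeviCivita
import Literature.Geometry.Lorentzian.Volume
import Literature.Topology.FourManifolds.ConnectedSum
import Literature.Geometry.Riemannian.IsotropicCurvature
import Literature.Topology.FourManifolds.HomotopyS4CompactProofs
import HarnessLib.Audit.Status.Attr

/-!
Route: OneHandleSplitting

DORMANT since 2026-08-22T23:13:31Z (reconciler: no traction for 5.7 d (last activity item-evidence-added at 2026-08-17T04:45:08Z); parked, not closed — `ledger route dormant route-SmoothPoincare4-OneHandleSplitting --off` to reactivate) — unstaffed, not closed; items shared with open routes are served there. `ledger route dormant <id> --off` reactivates.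

# Route OneHandleSplitting — Add a 1-handle, then fibre over the circle — almost-nonnegative Ricci
curvature on Σ#(S¹×S³) recognises S⁴ (HHWZ fibration / Cheeger–Colding splitting + Perelman + Cerf +
Budney–Gabai)

It suffices to show X = PINCHED STABILISATION (card one-handle-bochner-splitting, spine and only
card; existence half of its
"almost-splitting rigidity" reading, in the form whose recogniser is now a theorem): for every
closed smooth 4-manifold M homotopy
equivalent to S⁴ there is κ > 0 such that for every δ > 0 some connected sum P = M # (S¹×S³)
(relational
`Literature.Topology.FourManifolds.IsConnectedSum`, P modelled on 𝓡 4, S¹×S³ = 𝕊¹×𝕊³ with the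
product model (𝓡 1).prod (𝓡 3)) carries a
C^∞ Riemannian metric g with diam(P, g) ≤ 1, sec_g ≥ −κ and Ric_g ≥ −δ·g. Recognition is
theorem-level: by Huang–Huang–Wang–Zhu 2026
(arXiv:2605.24380, Main Thm 1: diam²·Ric ≥ −δ(n,κ), diam²·sec ≥ −κ ⇒ M fibres smoothly over
T^(b₁(M)) with connected fibres) such a P
fibres over S¹; the fibre is a closed simply connected 3-manifold (homotopy sequence, P ≃ S¹×S³),
hence S³ (Perelman), hence P ≅ S¹×S³
(π₀Diff⁺(S³) = 0, Cerf) — item FibrationRecognition; and ONE 1-HANDLE NEVER DISSOLVES A FAKE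
4-SPHERE: M # (S¹×S³) ≅ S¹×S³ ⇒ M ≅ S⁴
(Budney–Gabai 2019 Thm 3.13 + Γ₄ = 0) — item OneHandleCancellation. So SPC4 ⟺ X, and
unconditionally: an exotic Σ forces a MIXED
CURVATURE GAP on Σ # (S¹×S³) (no metric with diam = 1, sec ≥ −κ, Ric ≥ −δ(4,κ), for any κ). The
card's volume rung (vol ≥ v instead of
sec ≥ −κ: AlmostSplittingRigidity, Cheeger–Colding almost splitting + BPS 2024 + Perelman,
diffeo-stability OPEN) is filed as the
research crux with its own existence partner and a proved support assembly; the ε = 0 rung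
(Cheeger–Gromoll + Hamilton 1986 + Cerf)
is filed as support. Sibling card s1s3-remembers-fibering-perelman (not mine; "SPC4 = smooth
fibering of X_Σ over S¹ + Perelman")
gets here its curvature engine.
Lean: `∀ (M : Type) [TopologicalSpace M] [T2Space M] [SecondCountableTopology M] [ChartedSpace
(EuclideanSpace ℝ (Fin 4)) M] [IsManifold (𝓡 4) ∞ M] [CompactSpace M], M ≃ₕ Metric.sphere (0 :
EuclideanSpace ℝ (Fin 5)) 1 → ∃ κ : ℝ, 0 < κ ∧ ∀ δ : ℝ, 0 < δ → ∃ (P : Type) (_ : TopologicalSpace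
P) (_ : T2Space P) (_ : SecondCountableTopology P) (_ : ChartedSpace (EuclideanSpace ℝ (Fin 4)) P)
(_ : IsManifold (𝓡 4) ∞ P) (_ : CompactSpace P), Literature.Topology.FourManifolds.IsConnectedSum (𝓡
4) (𝓡 4) ((𝓡 1).prod (𝓡 3)) M ((Metric.sphere (0 : EuclideanSpace ℝ (Fin 2)) 1) × (Metric.sphere (0
: EuclideanSpace ℝ (Fin 4)) 1)) P ∧ ∃ g : Bundle.ContMDiffRiemannianMetric (𝓡 4) ∞ (EuclideanSpace ℝ
(Fin 4)) (TangentSpace (𝓡 4) : P → Type _), ∃ _ :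
(Literature.Geometry.Lorentzian.PseudoRiemannianMetric.ofRiemannian g).HasLeviCivita, (open Bundle
in letI : Bundle.RiemannianBundle (fun x : P ↦ TangentSpace (𝓡 4) x) :=
⟨g.toContinuousRiemannianMetric.toRiemannianMetric⟩; ∀ x y : P, Manifold.riemannianEDist (𝓡 4) x y ≤
1) ∧ (∀ (x : P) (X Y : TangentSpace (𝓡 4) x), -κ * (g.inner x X X * g.inner x Y Y - g.inner x X Y ^
2) ≤ (Literature.Geometry.Lorentzian.PseudoRiemannianMetric.ofRiemannian g).curvatureForm
(Literature.Geometry.Lorentzian.PseudoRiemannianMetric.ofRiemannian g).leviCivita x X Y Y X) ∧ (∀ (x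
: P) (w : TangentSpace (𝓡 4) x), -δ * g.inner x w w ≤
(Literature.Geometry.Lorentzian.PseudoRiemannianMetric.ofRiemannian g).ricci x w w)`

## Assembly
Pure logic plus one proved tree theorem: fix M ≃ₕ S⁴ with its atlas from the summit binder
(`SmoothPoincare4` unfolds to
`ContinuousMap.HomotopyEquiv.NonemptyDiffeomorphSphere M 4`); M is compact by
`Literature.Topology.FourManifolds.compactSpace_of_homotopyEquiv_sphere_four_holds M e`;
PinchedStabilisation gives κ, FibrationRecognition
gives δ(κ), PinchedStabilisation at δ gives P, g (diam ≤ 1, sec ≥ −κ, Ric ≥ −δ);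
StabilisationHomotopyType gives P ≃ₕ S¹×S³;
FibrationRecognition gives P ≅ S¹×S³; OneHandleCancellation gives `Nonempty (M ≃ₘ S⁴)`. PROVED in
the planner's Sketch.lean
(`assembly_holds`, 12 lines, lean check rc 0, 2026-08-15) — provable now.

Rationale: WHY THIS LINE. Nothing is known to see a homotopy 4-sphere Σ directly, but X_Σ := Σ # (S¹×S³) has b₁
= 1, and under (almost) nonnegative Ricci
curvature b₁ is STRUCTURE: a line splits off the universal cover (CheegerGromoll1971 Thm 3;
CheegerColding1996 almost splitting) or,
since May 2026, X_Σ fibres smoothly over S¹ (arXiv:2605.24380 Main Thm 1, the b₁ < n extension of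
Colding1997 / CheegerColding1997
Thm A.1.13 "b₁ = n ⇒ diffeomorphic to Tⁿ"), and the fibre/cross-section is 3-dimensional, where
recognition IS a theorem (Perelman2002,
Perelman2003a; Hamilton1986 Thm 1.2 at ε = 0) and π₀Diff⁺(S³) = 0 (CerfDiffeoSphere1968,
Hatcher1983) turns the S³-bundle into
S¹×S³; finally the 1-handle loses nothing because Diff(S¹×S³) is transitive on non-separating
3-spheres (BudneyGabai2019 Thm 3.13
p. 22, read), in contrast with S²×S² / ℂP² summands which dissolve Σ (WallJLMS1964; barrier
StableBarrierFour). Imported areas: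
comparison geometry with lower Ricci bounds (Cheeger–Colding theory, RCD regularity BruePigatiSemola
2024 = arXiv:2405.03839 Thm
1.4/1.8, Anderson 1990 short loops doi:10.4310/jdg/1214444097, PanWei2022 doi:10.4171/jems/1166,
SormaniWei2001), collapsing /
fibration theory (Yamaguchi, HHWZ 2026), 3-manifold Ricci flow, 4-dimensional handle/disc theory
(Budney–Gabai, Cerf). What it does
that prior routes do not: RicciFat asks Ric ≥ 3 + near-maximal volume ON Σ and recognises S⁴ by
CheegerColding1997 A.1.10; here the
curvature hypothesis is ALMOST-NONNEGATIVE Ricci on the b₁ = 1 host, the recogniser is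
fibering/splitting + 3-dimensional Poincaré,
and the negative reading is a new unconditional gap theorem for fake 4-spheres; the negatives index
is empty (2026-08-15).

RANKED CRUXES. #2 FibrationRecognition (crux) — (named-fact level, filed first per the cone rule)
for every κ > 0 there is δ > 0 such that every closed smooth 4-manifold P homotopy equivalent to
S¹×S³ carrying a C^∞ metric g with diam ≤ 1, sec_g ≥ −κ (Gram form: Rm(X,Y,Y,X) ≥ −κ(g(X,X)g(Y,Y) −
g(X,Y)²)) and Ric_g ≥ −δ·g is diffeomorphic to S¹×S³. Proof in print modulo assembly:
arXiv:2605.24380 Main Thm 1 (n = 4; diam ≤ 1 makes diam²·sec ≥ −κ, diam²·Ric ≥ −δ) ⇒ smooth fibre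
bundle P → T^(b₁) = S¹ with connected fibre F; π₂(S¹) = 0 and π₁(P) = ℤ ↠ π₁(S¹) force π₁(F) = 1; F
≅ S³ (Perelman); P = mapping torus of an orientation-preserving φ ∈ Diff(S³) (P orientable), φ
isotopic to id (Cerf Γ₄ = 0 / Hatcher) ⇒ P ≅ S³×S¹. [difficulty: XL] (why it might fail: Engine is a
May-2026 preprint (HHWZ Main Thm 1, δ = δ(4,κ) ineffective); transcription risks: fibre connected
but π₁F = 1 needs P ≃ S¹×S³ (b₁ = 1 alone gives lens-space bundles), C^∞ metric, diam ≤ 1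
normalisation; Perelman + Cerf supply the DIFFEOmorphism.) [arXiv:2605.24380, Perelman2002,
Perelman2003a, CerfDiffeoSphere1968, Hatcher1983, CheegerColding1997]
#3 PinchedStabilisation (crux) — the thesis X (existence half): for every closed smooth M ≃ₕ S⁴
there is κ > 0 such that for every δ > 0 some connected sum P = M # (S¹×S³) carries a C^∞ metric
with diam ≤ 1, sec ≥ −κ, Ric ≥ −δ·g. SPC4 ⇒ X by the product metric on S¹(a)×S³(b) (sec ≥ 0); X ⇒
SPC4 by FibrationRecognition + OneHandleCancellation. [deps: FibrationRecognition,
OneHandleCancellation] [difficulty: open-problem] (why it might fail: Zero slack: given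
FibrationRecognition and OneHandleCancellation it is equivalent to SPC4, false iff an exotic Σ
exists; no construction of almost-Ric ≥ 0 metrics on Σ#(S¹×S³) is known except through Σ ≅ S⁴, and
any witness must look like an S³-bundle over S¹ at unit scale.) [arXiv:2605.24380, Kirby1997,
FreedmanGompfMorrisonWalker2010, BudneyGabai2019]
#4 AlmostSplittingRigidity (crux) — (the card's crux AR, volume rung: noncollapsed almost-rigidity
of the Cheeger–Gromoll S¹×S³ theorem in dimension 4) for every v > 0 there is ε > 0 such that every
closed smooth P ≃ₕ S¹×S³ carrying a C^∞ metric with Ric ≥ −ε·g, Vol(P) ≥ v (Euclidean-normalised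
`riemannianMeasure`) and diam ≤ 1 is diffeomorphic to S¹×S³. Engine (G1, essentially theorem-level):
ℤ-covers converge to ℝ × Z with Z a compact simply connected noncollapsed RCD(0,3) topological
3-manifold (arXiv:2405.03839 Thm 1.4; Anderson 1990 short loops keep the deck group discrete and
free; PanWei2022 + SormaniWei2001 give π₁; Perelman: Z ≈ S³); (G2, OPEN) smooth stability: P ≅ S¹×S³
when the limit (ℝ×Z)/ℤ is singular (CheegerColding1997 Thm A.1.12 covers smooth limits only).
[difficulty: open-problem] (why it might fail: False without vol ≥ v (Anderson 1992: |Ric|→0, b₁ = k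
collapsing examples, no cover fibres over S¹); with vol ≥ v the limit (ℝ×Z)/ℤ may carry codim-2
singular circles where a fake 4-ball could bubble off (Perelman 1997-type gluing); diffeo-stability
is known for smooth limits only (CC97 A.1.12).) [CheegerColding1996, CheegerColding1997,
arXiv:2405.03839, doi:10.4310/jdg/1214444097, doi:10.4171/jems/1166,
doi:10.1090/s0002-9947-01-02802-1, doi:10.1215/S0012-7094-92-06803-7, Perelman1997BigVolume,
arXiv:1706.09490]
#5 AlmostNonnegRicciStabilisation (crux) — existence partner of the volume rung: for every closed
smooth M ≃ₕ S⁴ there is v > 0 such that for every ε > 0 some connected sum P = M # (S¹×S³) (with a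
Borel measurable structure) carries a C^∞ metric with Ric ≥ −ε·g, Vol ≥ v and diam ≤ 1 ("X_Σ is
volume-noncollapsed almost Ricci-nonnegative"). With AlmostSplittingRigidity it gives SPC4 through
the support item VolumeRungAssembly (proved in the planner's sketch); incomparable with
PinchedStabilisation (collapse allowed there, no sectional floor here). [deps:
AlmostSplittingRigidity, OneHandleCancellation] [difficulty: open-problem] (why it might fail: Zero
slack again (⟺ SPC4 given AlmostSplittingRigidity); Bishop–Gromov forbids hiding Σ's exotic topology
in an almost-flat region at small scale, so a witness on an exotic Σ would have to concentrate it
along singular circles of an S³-fibration-like limit — no construction known.) [CheegerColding1997,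
Colding1997, Perelman1997BigVolume, Kirby1997]
#9 OneHandleCancellation (support) — ONE 1-HANDLE NEVER DISSOLVES A FAKE 4-SPHERE (card rung L1, k =
1): for every closed smooth M ≃ₕ S⁴ and every relational connected sum P = M # (S¹×S³), P ≅ S¹×S³ ⇒
M ≅ S⁴. Proof in print modulo assembly: the fibre {θ}×S³ of the summand (after a Palais isotopy
making the summing disc small) is a non-separating 3-sphere F ⊂ P with P ∖ νF ≅ M°° (M minus two
balls); Diff(S¹×S³) is transitive on non-separating 3-spheres (BudneyGabai2019 Thm 3.13, p. 22
read), so the image of F has complement S³×I, whence M°° ≅ S³×I and M = M°° ∪ 2B⁴ ≅ S⁴ (Γ₄ = 0, tree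
fact `Literature.Topology.FourManifolds.cerf_twistedSphere_four`). Alternative elementary proof:
realise Aut(F₁) = ℤ/2 by a diffeo, isotope the core circle, surger (both framings give S⁴ on S¹×S³
and M on P). Mathematically provable now; formally long (relational gluing, both orientations of the
summand occur — harmless since S¹×S³ admits an orientation-reversing diffeomorphism). [difficulty:
L] [BudneyGabai2019, CerfDiffeoSphere1968, LaudenbachPoenaru1972, KervaireMilnorAnnals1963,
Kosinski1993]
#9 StabilisationHomotopyType (support) — bridge from the Σ-family to the recognisers' class: every
relational connected sum P of a closed smooth M ≃ₕ S⁴ with S¹×S³ is homotopy equivalent to S¹×S³ (M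
minus a disc is contractible with boundary S³, hence ≃ B⁴ rel ∂ by Whitehead; glue). Folklore;
needed because FibrationRecognition / AlmostSplittingRigidity / SplittingRecognition are stated over
all smooth homotopy S¹×S³'s (their natural generality), while existence is stated over the Σ-family
(equivalent to SPC4). [difficulty: M] [KervaireMilnorAnnals1963, HatcherAT2002, Kosinski1993]
#9 SplittingRecognition (support) — the ε = 0 rung (card rung L2, KNOWN): a closed smooth 4-manifold
P ≃ₕ S¹×S³ with a C^∞ metric of Ric ≥ 0 is diffeomorphic to S¹×S³. Proof in print: universal cover
splits isometrically ℝ^k × N with N compact (doi:10.4310/jdg/1214430220 = Cheeger–Gromoll 1971 Thm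
3), π₁ = ℤ forces k = 1 and N simply connected, N ≅ S³ (Hamilton1986 Thm 1.2, no Perelman needed),
the deck generator is (translation, isometry φ of N), so P is the mapping torus of an
orientation-preserving φ, ≅ S³×S¹ by Cerf. Consistency anchor of both recognisers (their ε → 0
limit) and the card's headline "Ric ≥ 0 on Σ#(S¹×S³) characterises S⁴"; to be vendored as Literature
facts. [difficulty: XL] [doi:10.4310/jdg/1214430220, Hamilton1986, CerfDiffeoSphere1968,
Hatcher1983]
#9 VolumeRungAssembly (support) — glue of the volume rung: AlmostSplittingRigidity →
StabilisationHomotopyType → OneHandleCancellation → AlmostNonnegRicciStabilisation →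
SmoothPoincare4. Pure logic plus the in-tree compactness theorem
`Literature.Topology.FourManifolds.compactSpace_of_homotopyEquiv_sphere_four_holds`; PROVED in the
planner's Sketch.lean (12 lines: unfold the summit, get v from existence, ε from rigidity, P and g
from existence, P ≃ₕ S¹×S³ from the bridge, P ≅ S¹×S³ from rigidity, M ≅ S⁴ from cancellation).
[difficulty: provable-now] [Kirby1997, HatcherAT2002]

TWO-LAYER PLAN. Foreseen glued splits (nothing filed now; k ≤ 3, depth 1). (a) FibrationRecognition
⇐ FibresOverCircle → FibreIsThreeSphere →
MappingTorusOfSphereStandard → FibrationRecognition: FibresOverCircle = HHWZ Main Thm 1 at n = 4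
vendored as a Literature fact and
restated over the tree's `Literature.Topology.FourManifolds.IsMappingTorusOf` ("P is the mapping
torus of some φ : F ≃ₘ F, F a closed
connected 3-manifold"); FibreIsThreeSphere = homotopy sequence + Perelman (F simply connected closed
⇒ F ≅ S³); MappingTorusOfSphereStandard
= Cerf/Hatcher (orientation-preserving φ of S³ ⇒ mapping torus ≅ S¹×S³), with
`nonempty_diffeomorph_of_isMappingTorusOf` for transport.
(b) AlmostSplittingRigidity ⇐ LimitStructure → SmoothStabilityS1S3 → AlmostSplittingRigidity:
LimitStructure (G1) = equivariant limits of
the ℤ-covers are ℝ × Z with Z ≈ S³ a noncollapsed RCD(0,3) topological manifold (arXiv:2405.03839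
Thm 1.4 + Anderson 1990 + PanWei2022 +
SormaniWei2001 + Perelman — theorem-level once RCD/GH notions are typed); SmoothStabilityS1S3 (G2,
the open core) = noncollapsed P_i ≃ S¹×S³
with Ric ≥ −ε_i converging to (ℝ×Z)/ℤ are eventually diffeomorphic to S¹×S³ (fake-ball bubbles
excluded). (c) OneHandleCancellation ⇐
NonSeparatingTransitivity (BudneyGabai2019 Thm 3.13 as a fact) → ComplementProduct → (tree fact
`cerf_twistedSphere_four`). (d)
PinchedStabilisation / AlmostNonnegRicciStabilisation are never split here; their only foreseen
children are restrictions to candidate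
families (Gluck twists Σ_K, Cappell–Shaneson spheres) as special cases.

KILL CRITERIA. An exotic homotopy 4-sphere proved anywhere refutes PinchedStabilisation and
AlmostNonnegRicciStabilisation at once — close
`refuted:PinchedStabilisation`. If HHWZ Main Thm 1 is withdrawn or fails at n = 4,
FibrationRecognition loses its engine: pivot the main
assembly to the volume rung (VolumeRungAssembly, already typed and proved) or restate existence at ε
= 0 ("Ric ≥ 0 on Σ#(S¹×S³)", recognised
by SplittingRecognition, a 1971+1986 theorem). A refutation of AlmostSplittingRigidity by a genuine
sequence would itself exhibit new
exotica (an exotic S¹×S³); a refutation of its G2 mechanism (fake-ball or other bubbles surviving in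
noncollapsed almost-Ric ≥ 0 limits on
smooth homotopy S¹×S³'s) kills only the volume rung — drop AlmostSplittingRigidity,
AlmostNonnegRicciStabilisation, VolumeRungAssembly; the
main chain is unaffected. OneHandleCancellation or StabilisationHomotopyType refuted would mean a
mis-typing (both are theorems in print)
— restate, do not close. Mooted by: SPC4 itself, or a direct proof that Σ#(S¹×S³) ≅ S¹×S³ for all Σ
(then close superseded in favour of
whichever route proved it).

NOT DECOMPOSED YET. The constants δ(4,κ) (HHWZ, by contradiction, ineffective) and ε(v); the k-fold
rung Σ #k(S¹×S³) ≅ #k(S¹×S³) ⇒ Σ ≅ S⁴ (handle slides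
realise Out(F_k), LaudenbachPoenaru1972) — only k = 1 is load-bearing; the T⁴-host variant
(CheegerColding1997 A.1.13 recognises T⁴#Σ ≅ T⁴
unconditionally, but cancellation T⁴#Σ ≅ T⁴ ⇒ Σ ≅ S⁴ needs a Schoenflies-type input — that is route
SchoenfliesSplit's territory); the
non-orientable twin S¹×~S³; the ε = 0 existence statement (Ric ≥ 0 on Σ#(S¹×S³), strictly stronger
than X, not filed); the consistency
implications SmoothPoincare4 → PinchedStabilisation / AlmostNonnegRicciStabilisation (product metric
on a re-modelled copy of S¹×S³;
formal bookkeeping only); packaging over `Literature.Topology.FourManifolds.HomotopySphere 4`;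
RCD/Gromov–Hausdorff vocabulary for the
G1/G2 split (no Lean notions yet — definition requests deferred to tenure, when
AlmostSplittingRigidity is actually split).

CHEAPEST FALSIFIER. Lookups, all run this session. (i) arXiv:2605.24380 p. 3 (Main Thm 1: diam²Ric ≥
−δ(n,κ), diam²sec ≥ −κ ⇒ "fibers over a
b₁(M)-torus with connected fibers") and p. 14 ("F is a smooth fiber bundle map") confirm
FibrationRecognition's engine; p. 3 also records
Anderson 1992's collapsing counterexamples (|Ric| → 0, b₁ = k, no cover fibres over S¹, n ≥ 4) — WHY
the volume rung carries vol ≥ v and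
the main rung sec ≥ −κ: a volume-free, sec-free recogniser dies on that lookup. (ii)
CheegerColding1997 p. 459 read: A.1.12
(diffeo-stability for smooth compact limits), A.1.13 (b₁ = n ⇒ DIFFEOMORPHIC to Tⁿ) — the model.
(iii) BudneyGabai2019 p. 22 read: Thm 3.13
verbatim. (iv) Still TO RUN by a refuter (exotica-free, cheapest real test): metrics g_i on the
STANDARD S¹×S³ with Ric ≥ −1/i, diam ≤ 1,
vol ≥ v whose ℤ-covers converge to ℝ × Z with Z not homeomorphic to S³ — by arXiv:2405.03839 Thm 1.4
+ PanWei2022 this should be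
impossible; success kills the volume rung's G1. (v) Sanity: S¹(a)×S³(b) with π²(a²+b²) ≤ 1 has sec ≥
0, so SPC4 ⇒ X for every κ — the
thesis is not vacuous-by-normalisation.

NUMBERS. δ(4,κ) of arXiv:2605.24380 Main Thm 1 and δ(n) of CheegerColding1997 A.1.13: ineffective
(compactness/contradiction). Normalisation: diam ≤ 1,
Ric ≥ −δ·g, sec ≥ −κ in Gram form Rm(X,Y,Y,X) ≥ −κ(g(X,X)g(Y,Y) − g(X,Y)²), Vol =
Euclidean-normalised `riemannianMeasure` (unit round S³ has
volume 2π², so S¹(a)×S³(b) has Vol = 4π³ab³). Anderson 1990 (doi:10.4310/jdg/1214444097): with Ric ≥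
−(n−1), vol B₁ ≥ v, loops of length
< ε(n,v) have order ≤ N(n,v) in π₁ — for torsion-free π₁ = ℤ the systole is ≥ ε(4,v). Singular
strata of noncollapsed limits have
codimension ≥ 2 (CheegerColding1997 §6). Items at open: 9 (4 cruxes, 4 support, 1 assembly).

DEFINITION REQUESTS. None needed to type the nine items. Cite facts wanted (family spc4, for the
layer-2 splits): F1 arXiv:2605.24380 Main Thm 1 at n = 4,
b₁ = 1, over `Literature.Topology.FourManifolds.IsMappingTorusOf`; F2 Perelman — closed simply
connected smooth 3-manifold ≅ S³; F3
π₀Diff⁺(S³) = 0 ⇒ mapping torus of an orientation-preserving self-diffeo of S³ is ≅ S¹×S³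
(CerfDiffeoSphere1968 / Hatcher1983); F4
BudneyGabai2019 Thm 3.13; F5 Cheeger–Gromoll 1971 Thm 3 + Hamilton1986 Thm 1.2; F6
CheegerColding1997 Thm A.1.12; F7 arXiv:2405.03839
Thm 1.4; F8 Anderson 1990 short-loop finiteness. Literature acquisition filed: Anderson 1992
(doi:10.1215/S0012-7094-92-06803-7, acq-02506).

Novelty: Searches (2026-08-15): `lit frontier SmoothPoincare4 --since 2020` (30 rows: triangulation census,
Dunfield–Gong sphere standard,
exotic knot traces, families gauge theory — none Riemannian); `lit bridges SmoothPoincare4 --cross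
any` (30, noise); `lit galaxy search
"almost nonnegative Ricci curvature" --star all` (11 panama books: Grove–Petersen Comparison
Geometry, Tao, Tian 2023 surveys; pdf/crabby
0); `lit galaxy search --star pdf --mode bm25 "closed 4-manifolds with fundamental group Z …
Cheeger–Gromoll / Cheeger–Colding"` (15,
noise); `lit vsearch "Ric ≥ −ε, diam ≤ 1, b₁ = n ⇒ torus …" --no-graph` (10 books, Grove–Petersen
pp. 274/291); `lit search --source
s2 "almost nonnegative Ricci curvature diffeomorphism torus"` (8: FOUND arXiv:2605.24380
Huang–Huang–Wang–Zhu 2026; Cai 1993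
doi:10.1007/bf00773552; Wei 1990; Chen–Ge–Han 2022); `lit search --source zbmath "almost nonnegative
Ricci curvature torus
diffeomorphic"` (4: Shen–Wei 1991, Cai 1993, Cao–Zhu 2006, Paeng 1999); local searchd unavailable
(rc 75 ×4), OpenAlex budget exhausted,
S2 rate-limited after one query; full reads with page checks: arXiv:2605.24380 (pp. 2–5, 13–15),
arXiv:2405.03839 (pp. 3–5, 9–10),
doi:10.4310/jdg/1214459974 (p. 459), arXiv:1912.09029 (p. 22), doi:10.4310/jdg/1214430220 (Thm 3),
doi:10.4310/jdg/1214440433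
(Thm 1.2); `ledger negatives` (0); `ledger idea list` (≈130 cards: siblings
s1s3-remembers-fibering-perelman (variant, open),
circular-kirby-calculus-rotation (open), ricci-fat-homotopy-b  [refs: 10.1007/bf00773552, 10.4310/jdg/1214459974, 10.4310/jdg/1214430220, 10.4310/jdg/1214440433, 2605.24380, 2405.03839, 1912.09029, doi:10.1007/bf00773552, doi:10.4310/jdg/1214459974, doi:10.4310/jdg/1214430220, doi:10.4310/jdg/1214440433, CheegerColding1997, BudneyGabai2019, Hamilton1986]

Barriers (technique_class: ricci-almost-splitting, S1xS3-stabilisation, fibering): - technique_class: ricci-almost-splitting, S1xS3-stabilisation, fibering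
- Literature.Barriers.SmoothPoincare4.StableBarrierFour: evaded and inverted — S²×S²-stabilisation
forgets Σ (Wall), whereas OneHandleCancellation PROVES that one S¹×S³ summand remembers Σ exactly;
no invariant of a stabilisation is evaluated.
- Literature.Barriers.SmoothPoincare4.HCobordismInvariantBarrierFour: evaded — the certificate is a
Riemannian metric on Σ#(S¹×S³) whose existence FibrationRecognition proves to separate S⁴ from every
exotic Σ, so it is constant on no h-cobordism class; honest flip side: it is not computable on a
given candidate, no refutation engine is claimed.
- Literature.Barriers.SmoothPoincare4.TopologicalBarrierFour: evaded — all hypotheses are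
smooth-metric (sec, Ric, diam, vol of the smooth structure's own metrics); Freedman enters nowhere
(the bridge item is a homotopy equivalence, not a homeomorphism).
- Literature.Barriers.SmoothPoincare4.HCobordismBarrierFour: not engaged — no h-cobordism ⇒
diffeomorphism step; diffeomorphisms come from HHWZ's smooth fibration + Perelman + Cerf (main rung)
or Cheeger–Colding Reifenberg charts (volume rung) and from Budney–Gabai disc/sphere transitivity.
- Literature.Barriers.SmoothPoincare4.TwistedSphereBarrierFour: used positively only (Γ₄ = 0 closes
M°° ∪ 2B⁴ ≅ S⁴ and trivialises S³-bundles over S¹); nothing exotic is built from Diff(S³).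
- Literature.Barriers.SmoothPoincare4.CircleActionBarrierFour: consistent — the conclusion P ≅ S¹

Novelty grade: new-combination — ROUTE REVIEW (refuter rreview d2aef6b8, 2026-08-15): KEEP OPEN, no blocking objection, one structural remark. Typing verified: curvatureForm/ricci conventions make the Gram-form hypothesis exactly sec ≥ −κ and Ric ≥ −δg; HasLeviCivita is a Prop about g (no junk witness); IsConnectedSum = genuine Ker (refuter refuter-rreview-route-CriticalPhenomena--d2aef6b8-0, 2026-08-15T13:45:40Z; prior: arXiv:2605.24380, arXiv:1912.09029, CheegerColding1997, doi:10.4310/jdg/1214430220, Colding1997)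

History (route lifecycle, newest last):
- 2026-08-22T23:13:31Z · DORMANT — reconciler: no traction for 5.7 d (last activity item-evidence-added at 2026-08-17T04:45:08Z); parked, not closed — `ledger route dormant route-SmoothPoincare4- (operator:999:2781681)

sub-problem: SmoothPoincare4 · status: dormant · opened planner-plancard-SmoothPoincare4-SmoothPoinca-5e8e9c8b-0 2026-08-15T12:28:02Z · rev 4 · ledger route-SmoothPoincare4-OneHandleSplitting
GENERATED by the gate from the ledger (D-0016/17). Provers cite these decls: `theorem foo : Summit.SmoothPoincare4.SmoothPoincare4.Theses.OneHandleSplitting.<Decl> := …` in Summits/SmoothPoincare4/SmoothPoincare4/Theorems/<Name>.lean.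
-/

namespace Summit.SmoothPoincare4.SmoothPoincare4.Theses.OneHandleSplitting

open scoped BigOperators Topology Manifold Classical MeasureTheory ProbabilityTheory Matrix InnerProductSpace ComplexConjugate ContinuousMap ContDiff
open Filter Set Function TopologicalSpace MeasureTheory

attribute [summit_statement] _root_.SmoothPoincare4

open Literature.SPC4

/-- item stmt-SmoothPoincare4-8117 · crux · rank 2 · open · by planner
why it might fail: Engine is a May-2026 preprint (HHWZ Main Thm 1, δ = δ(4,κ) ineffective); transcription risks: fibre connected but π₁F = 1 needs P ≃ S¹×S³ (b₁ = 1 alone gives lens-space bundles), C^∞ metric, diam ≤ 1 normalisation; Perelman + Cerf supply the DIFFEOmorphism.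
sources: arXiv:2605.24380, Perelman2002, Perelman2003a, CerfDiffeoSphere1968, Hatcher1983, CheegerColding1997
[crux] (named-fact level, filed first per the cone rule) for every κ > 0 there is δ > 0 such that
every closed smooth 4-manifold P homotopy equivalent to S¹×S³ carrying a C^∞ metric g with diam ≤ 1,
sec_g ≥ −κ (Gram form: Rm(X,Y,Y,X) ≥ −κ(g(X,X)g(Y,Y) − g(X,Y)²)) and Ric_g ≥ −δ·g is diffeomorphic
to S¹×S³. Proof in print modulo assembly: arXiv:2605.24380 Main Thm 1 (n = 4; diam ≤ 1 makes
diam²·sec ≥ −κ, diam²·Ric ≥ −δ) ⇒ smooth fibre bundle P → T^(b₁) = S¹ with connected fibre F; π₂(S¹)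
= 0 and π₁(P) = ℤ ↠ π₁(S¹) force π₁(F) = 1; F ≅ S³ (Perelman); P = mapping torus of an
orientation-preserving φ ∈ Diff(S³) (P orientable), φ isotopic to id (Cerf Γ₄ = 0 / Hatcher) ⇒ P ≅
S³×S¹. [difficulty: XL] -/
@[route_item "route-SmoothPoincare4-OneHandleSplitting", crux]
def FibrationRecognition : Prop :=
  (∀ (F : Type) [TopologicalSpace F] [T2Space F] [SecondCountableTopology F] [ChartedSpace (EuclideanSpace ℝ (Fin 3)) F] [IsManifold (𝓡 3) ∞ F] [SimplyConnectedSpace F] [CompactSpace F], Nonempty (F ≃ₘ⟮𝓡 3, 𝓡 3⟯ (Metric.sphere (0 : EuclideanSpace ℝ (Fin 4)) 1))) → (∀ (φ ψ χ : (Metric.sphere (0 : EuclideanSpace ℝ (Fin 4)) 1) ≃ₘ⟮𝓡 3, 𝓡 3⟯ (Metric.sphere (0 : EuclideanSpace ℝ (Fin 4)) 1)), (∃ F : ℝ → (Metric.sphere (0 : EuclideanSpace ℝ (Fin 4)) 1) → (Metric.sphere (0 : EuclideanSpace ℝ (Fin 4)) 1), ContMDiff (𝓘(ℝ, ℝ).prod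 (𝓡 3)) (𝓡 3) ∞ (Function.uncurry F) ∧ (∀ t : ℝ, Manifold.IsSmoothEmbedding (𝓡 3) (𝓡 3) ∞ (F t)) ∧ F 0 = ⇑φ ∧ F 1 = ⇑ψ) ∨ (∃ F : ℝ → (Metric.sphere (0 : EuclideanSpace ℝ (Fin 4)) 1) → (Metric.sphere (0 : EuclideanSpace ℝ (Fin 4)) 1), ContMDiff (𝓘(ℝ, ℝ).prod (𝓡 3)) (𝓡 3) ∞ (Function.uncurry F) ∧ (∀ t : ℝ, Manifold.IsSmoothEmbedding (𝓡 3) (𝓡 3) ∞ (F t)) ∧ F 0 = ⇑ψ ∧ F 1 = ⇑χ) ∨ (∃ F : ℝ → (Metric.sphere (0 : EuclideanSpace ℝ (Fin 4)) 1) → (Metric.sphere (0 : EuclideanSpace ℝ (Fin 4)) 1), ContMDiff (𝓘(ℝ, ℝ).prod (𝓡 3)) (𝓡 3) ∞ (Function.uncurry F) ∧ (∀ t : ℝ, Manifold.IsSmoothEmbedding (𝓡 3) (𝓡 3) ∞ (F t)) ∧ F 0 = ⇑φ ∧ F 1 = ⇑χ)) → (∀ κ : ℝ, 0 < κ → ∃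 δ : ℝ, 0 < δ ∧ ∀ (P : Type) [TopologicalSpace P] [T2Space P] [SecondCountableTopology P] [ChartedSpace (EuclideanSpace ℝ (Fin 4)) P] [IsManifold (𝓡 4) ∞ P] [CompactSpace P], P ≃ₕ ((Metric.sphere (0 : EuclideanSpace ℝ (Fin 2)) 1) × (Metric.sphere (0 : EuclideanSpace ℝ (Fin 4)) 1)) → ∀ (g : Bundle.ContMDiffRiemannianMetric (𝓡 4) ∞ (EuclideanSpace ℝ (Fin 4)) (TangentSpace (𝓡 4) : P → Type _)) [(Literature.Geometry.Lorentzian.PseudoRiemannianMetric.ofRiemannian g).HasLeviCivita], (open Bundle in letI : Bundle.RiemannianBundle (fun x : P ↦ TangentSpace (𝓡 4) x) := ⟨g.toContinuousRiemannianMetric.toRiemannianMetric⟩; ∀ x y : P, Manifold.riemannianEDist (𝓡 4) x y ≤ 1) → (∀ (x : P) (X Y : TangentSpace (𝓡 4) x), -κ * (g.inner x X X * g.inner x Y Y - g.inner x X Y ^ 2) ≤ (Literature.Geometry.Lorentzian.PseudoRiemannianMetric.ofRiemannian g).curvatureForm (Literature.Geometry.Lorentzian.PseudoRiemannianMetric.ofRiemannian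 g).leviCivita x X Y Y X) → (∀ (x : P) (w : TangentSpace (𝓡 4) x), -δ * g.inner x w w ≤ (Literature.Geometry.Lorentzian.PseudoRiemannianMetric.ofRiemannian g).ricci x w w) → ∃ f : P → (Metric.sphere (0 : EuclideanSpace ℝ (Fin 2)) 1), ContMDiff (𝓡 4) (𝓡 1) ∞ f ∧ (∀ x : P, Function.Surjective (mfderiv (𝓡 4) (𝓡 1) f x)) ∧ ∀ θ : (Metric.sphere (0 : EuclideanSpace ℝ (Fin 2)) 1), IsConnected (f ⁻¹' {θ})) → ∀ κ : ℝ, 0 < κ → ∃ δ : ℝ, 0 < δ ∧ ∀ (P : Type) [TopologicalSpace P] [T2Space P] [SecondCountableTopology P] [ChartedSpace (EuclideanSpace ℝ (Fin 4)) P] [IsManifold (𝓡 4) ∞ P] [CompactSpace P], P ≃ₕ ((Metric.sphere (0 : EuclideanSpace ℝ (Fin 2)) 1) × (Metric.sphere (0 : EuclideanSpace ℝ (Fin 4)) 1)) → ∀ (g : Bundle.ContMDiffRiemannianMetric (𝓡 4) ∞ (EuclideanSpace ℝ (Fin 4)) (TangentSpace (𝓡 4) : P → Type _)) [(Literature.Geometry.Lorentzian.PseudoRiemannianMetric.ofRiemannian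 g).HasLeviCivita], (open Bundle in letI : Bundle.RiemannianBundle (fun x : P ↦ TangentSpace (𝓡 4) x) := ⟨g.toContinuousRiemannianMetric.toRiemannianMetric⟩; ∀ x y : P, Manifold.riemannianEDist (𝓡 4) x y ≤ 1) → (∀ (x : P) (X Y : TangentSpace (𝓡 4) x), -κ * (g.inner x X X * g.inner x Y Y - g.inner x X Y ^ 2) ≤ (Literature.Geometry.Lorentzian.PseudoRiemannianMetric.ofRiemannian g).curvatureForm (Literature.Geometry.Lorentzian.PseudoRiemannianMetric.ofRiemannian g).leviCivita x X Y Y X) → (∀ (x : P) (w : TangentSpace (𝓡 4) x), -δ * g.inner x w w ≤ (Literature.Geometry.Lorentzian.PseudoRiemannianMetric.ofRiemannian g).ricci x w w) → Nonempty (P ≃ₘ⟮𝓡 4, (𝓡 1).prod (𝓡 3)⟯ ((Metric.sphere (0 : EuclideanSpace ℝ (Fin 2)) 1) × (Metric.sphere (0 : EuclideanSpace ℝ (Fin 4)) 1)))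

/-- item stmt-SmoothPoincare4-8118 · crux · rank 3 · open · by planner
why it might fail: Zero slack: given FibrationRecognition and OneHandleCancellation it is equivalent to SPC4, false iff an exotic Σ exists; no construction of almost-Ric ≥ 0 metrics on Σ#(S¹×S³) is known except through Σ ≅ S⁴, and any witness must look like an S³-bundle over S¹ at unit scale.
sources: arXiv:2605.24380, Kirby1997, FreedmanGompfMorrisonWalker2010, BudneyGabai2019
[crux] the thesis X (existence half): for every closed smooth M ≃ₕ S⁴ there is κ > 0 such that for
every δ > 0 some connected sum P = M # (S¹×S³) carries a C^∞ metric with diam ≤ 1, sec ≥ −κ, Ric ≥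
−δ·g. SPC4 ⇒ X by the product metric on S¹(a)×S³(b) (sec ≥ 0); X ⇒ SPC4 by FibrationRecognition +
OneHandleCancellation. [deps: FibrationRecognition, OneHandleCancellation] [difficulty:
open-problem] -/
@[route_item "route-SmoothPoincare4-OneHandleSplitting", crux]
def PinchedStabilisation : Prop :=
  ∀ (M : Type) [TopologicalSpace M] [T2Space M] [SecondCountableTopology M] [ChartedSpace (EuclideanSpace ℝ (Fin 4)) M] [IsManifold (𝓡 4) ∞ M] [CompactSpace M], M ≃ₕ Metric.sphere (0 : EuclideanSpace ℝ (Fin 5)) 1 → ∃ κ : ℝ, 0 < κ ∧ ∀ δ : ℝ, 0 < δ → ∃ (P : Type) (_ : TopologicalSpace P) (_ : T2Space P) (_ : SecondCountableTopology P) (_ : ChartedSpace (EuclideanSpace ℝ (Fin 4)) P) (_ : IsManifold (𝓡 4) ∞ P) (_ : CompactSpace P), Literature.Topology.FourManifolds.IsConnectedSum (𝓡 4) (𝓡 4) ((𝓡 1).prod (𝓡 3)) M ((Metric.sphere (0 : EuclideanSpace ℝ (Fin 2)) 1) × (Metric.sphere (0 : EuclideanSpace ℝ (Fin 4)) 1))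 P ∧ ∃ g : Bundle.ContMDiffRiemannianMetric (𝓡 4) ∞ (EuclideanSpace ℝ (Fin 4)) (TangentSpace (𝓡 4) : P → Type _), ∃ _ : (Literature.Geometry.Lorentzian.PseudoRiemannianMetric.ofRiemannian g).HasLeviCivita, (open Bundle in letI : Bundle.RiemannianBundle (fun x : P ↦ TangentSpace (𝓡 4) x) := ⟨g.toContinuousRiemannianMetric.toRiemannianMetric⟩; ∀ x y : P, Manifold.riemannianEDist (𝓡 4) x y ≤ 1) ∧ (∀ (x : P) (X Y : TangentSpace (𝓡 4) x), -κ * (g.inner x X X * g.inner x Y Y - g.inner x X Y ^ 2) ≤ (Literature.Geometry.Lorentzian.PseudoRiemannianMetric.ofRiemannian g).curvatureForm (Literature.Geometry.Lorentzian.PseudoRiemannianMetric.ofRiemannian g).leviCivita x X Y Y X) ∧ (∀ (x : P) (w : TangentSpace (𝓡 4) x), -δ * g.inner x w w ≤ (Literature.Geometry.Lorentzian.PseudoRiemannianMetric.ofRiemannian g).ricci x w w)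

/-- item stmt-SmoothPoincare4-8119 · crux · rank 4 · open · by planner
why it might fail: False without vol ≥ v (Anderson 1992: |Ric|→0, b₁ = k collapsing examples, no cover fibres over S¹); with vol ≥ v the limit (ℝ×Z)/ℤ may carry codim-2 singular circles where a fake 4-ball could bubble off (Perelman 1997-type gluing); diffeo-stability is known for smooth limits only (CC97 A.1.12).
sources: CheegerColding1996, CheegerColding1997, arXiv:2405.03839, doi:10.4310/jdg/1214444097, doi:10.4171/jems/1166, doi:10.1090/s0002-9947-01-02802-1
[crux] (the card's crux AR, volume rung: noncollapsed almost-rigidity of the Cheeger–Gromoll S¹×S³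
theorem in dimension 4) for every v > 0 there is ε > 0 such that every closed smooth P ≃ₕ S¹×S³
carrying a C^∞ metric with Ric ≥ −ε·g, Vol(P) ≥ v (Euclidean-normalised `riemannianMeasure`) and
diam ≤ 1 is diffeomorphic to S¹×S³. Engine (G1, essentially theorem-level): ℤ-covers converge to ℝ ×
Z with Z a compact simply connected noncollapsed RCD(0,3) topological 3-manifold (arXiv:2405.03839
Thm 1.4; Anderson 1990 short loops keep the deck group discrete and free; PanWei2022 +
SormaniWei2001 give π₁; Perelman: Z ≈ S³); (G2, OPEN) smooth stability: P ≅ S¹×S³ when the limit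
(ℝ×Z)/ℤ is singular (CheegerColding1997 Thm A.1.12 covers smooth limits only). [difficulty:
open-problem] -/
@[route_item "route-SmoothPoincare4-OneHandleSplitting"]
def AlmostSplittingRigidity : Prop :=
  ∀ v : ℝ, 0 < v → ∃ ε : ℝ, 0 < ε ∧ ∀ (P : Type) [TopologicalSpace P] [T2Space P] [SecondCountableTopology P] [ChartedSpace (EuclideanSpace ℝ (Fin 4)) P] [IsManifold (𝓡 4) ∞ P] [CompactSpace P] [MeasurableSpace P] [BorelSpace P], P ≃ₕ ((Metric.sphere (0 : EuclideanSpace ℝ (Fin 2)) 1) × (Metric.sphere (0 : EuclideanSpace ℝ (Fin 4)) 1)) → ∀ (g : Bundle.ContMDiffRiemannianMetric (𝓡 4) ∞ (EuclideanSpace ℝ (Fin 4)) (TangentSpace (𝓡 4) : P → Type _)) [(Literature.Geometry.Lorentzian.PseudoRiemannianMetric.ofRiemannian g).HasLeviCivita], (∀ (x : P) (w : TangentSpace (𝓡 4) x), -ε * g.inner x w w ≤ (Literature.Geometry.Lorentzian.PseudoRiemannianMetric.ofRiemannian g).ricci x w w) → ENNReal.ofReal v ≤ Literature.Geometry.Lorentzian.riemannianMeasure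 g Set.univ → (open Bundle in letI : Bundle.RiemannianBundle (fun x : P ↦ TangentSpace (𝓡 4) x) := ⟨g.toContinuousRiemannianMetric.toRiemannianMetric⟩; ∀ x y : P, Manifold.riemannianEDist (𝓡 4) x y ≤ 1) → Nonempty (P ≃ₘ⟮𝓡 4, (𝓡 1).prod (𝓡 3)⟯ ((Metric.sphere (0 : EuclideanSpace ℝ (Fin 2)) 1) × (Metric.sphere (0 : EuclideanSpace ℝ (Fin 4)) 1)))

/-- item stmt-SmoothPoincare4-8120 · crux · rank 5 · open · by planner
why it might fail: Zero slack again (⟺ SPC4 given AlmostSplittingRigidity); Bishop–Gromov forbids hiding Σ's exotic topology in an almost-flat region at small scale, so a witness on an exotic Σ would have to concentrate it along singular circles of an S³-fibration-like limit — no construction known.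
sources: CheegerColding1997, Colding1997, Perelman1997BigVolume, Kirby1997
[crux] existence partner of the volume rung: for every closed smooth M ≃ₕ S⁴ there is v > 0 such
that for every ε > 0 some connected sum P = M # (S¹×S³) (with a Borel measurable structure) carries
a C^∞ metric with Ric ≥ −ε·g, Vol ≥ v and diam ≤ 1 ("X_Σ is volume-noncollapsed almost
Ricci-nonnegative"). With AlmostSplittingRigidity it gives SPC4 through the support item
VolumeRungAssembly (proved in the planner's sketch); incomparable with PinchedStabilisation
(collapse allowed there, no sectional floor here). [deps: AlmostSplittingRigidity,
OneHandleCancellation] [difficulty: open-problem] -/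
@[route_item "route-SmoothPoincare4-OneHandleSplitting"]
def AlmostNonnegRicciStabilisation : Prop :=
  ∀ (M : Type) [TopologicalSpace M] [T2Space M] [SecondCountableTopology M] [ChartedSpace (EuclideanSpace ℝ (Fin 4)) M] [IsManifold (𝓡 4) ∞ M] [CompactSpace M], M ≃ₕ Metric.sphere (0 : EuclideanSpace ℝ (Fin 5)) 1 → ∃ v : ℝ, 0 < v ∧ ∀ ε : ℝ, 0 < ε → ∃ (P : Type) (_ : TopologicalSpace P) (_ : T2Space P) (_ : SecondCountableTopology P) (_ : ChartedSpace (EuclideanSpace ℝ (Fin 4)) P) (_ : IsManifold (𝓡 4) ∞ P) (_ : CompactSpace P) (_ : MeasurableSpace P) (_ : BorelSpace P), Literature.Topology.FourManifolds.IsConnectedSum (𝓡 4) (𝓡 4) ((𝓡 1).prod (𝓡 3)) M ((Metric.sphere (0 : EuclideanSpace ℝ (Fin 2)) 1) × (Metric.sphere (0 : EuclideanSpace ℝ (Fin 4)) 1)) P ∧ ∃ g : Bundle.ContMDiffRiemannianMetric (𝓡 4) ∞ (EuclideanSpace ℝ (Fin 4)) (TangentSpace (𝓡 4) : P → Type _),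 ∃ _ : (Literature.Geometry.Lorentzian.PseudoRiemannianMetric.ofRiemannian g).HasLeviCivita, (∀ (x : P) (w : TangentSpace (𝓡 4) x), -ε * g.inner x w w ≤ (Literature.Geometry.Lorentzian.PseudoRiemannianMetric.ofRiemannian g).ricci x w w) ∧ ENNReal.ofReal v ≤ Literature.Geometry.Lorentzian.riemannianMeasure g Set.univ ∧ (open Bundle in letI : Bundle.RiemannianBundle (fun x : P ↦ TangentSpace (𝓡 4) x) := ⟨g.toContinuousRiemannianMetric.toRiemannianMetric⟩; ∀ x y : P, Manifold.riemannianEDist (𝓡 4) x y ≤ 1)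

/-- item stmt-SmoothPoincare4-10767 · crux · rank 8 · open · by planner
why it might fail: A THEOREM (Perelman; MorganTian2007 Thm 0.1/Cor 0.2(a), statement audited faithful) — risk is closure, not truth: XL; no 3-D Ricci flow with surgery (MT 15.9) / finite extinction (MT 18.1) in Mathlib or tree; one layer = Lines/birth.lean, hardest stub SurgeryFlowExtinct.
sources: Perelman2002Entropy, Perelman2003a, Perelman2003b, MorganTian2007, Hamilton1982, arXiv:math/0211159
[support] APEX INPUT (a published theorem restated verbatim as a route hypothesis, inlined rather
than imported per the cone discipline of this route; NOT a prover target — it closes by one line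
`theorem … : PoincareThreeSphere := nonempty_diffeomorph_sphere_three_holds` the day the Literature
named fact `Literature.Topology.FourManifolds.nonempty_diffeomorph_sphere_three` (SPC4Wave0,
spc4.S31) is discharged; it is definitionally that fact at universe 0, checked by `Iff.rfl` in the
planner's Sketch.lean). Perelman 2002–03 / Morgan–Tian 2007 Cor. 0.2 (a): a closed, simply connected
smooth 3-manifold is diffeomorphic to S³. This is the first antecedent already inlined in
FibrationRecognition and Assembly; filing it as an item lets the deciding theorem `closes` name it
(D-0027 §2.1: hypotheses ⊆ items). Sources: Perelman2002, Perelman2003a, MorganTian2007. -/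
@[route_item "route-SmoothPoincare4-OneHandleSplitting", crux]
def PoincareThreeSphere : Prop :=
  ∀ (F : Type) [TopologicalSpace F] [T2Space F] [SecondCountableTopology F] [ChartedSpace (EuclideanSpace ℝ (Fin 3)) F] [IsManifold (𝓡 3) ∞ F] [SimplyConnectedSpace F] [CompactSpace F], Nonempty (F ≃ₘ⟮𝓡 3, 𝓡 3⟯ (Metric.sphere (0 : EuclideanSpace ℝ (Fin 4)) 1))

/-- item stmt-SmoothPoincare4-10788 · support · rank 8 · open · by planner
[support] APEX INPUT (published theorem restated as a route hypothesis; NOT a prover target). Cerf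
1968, Ch. I §1 Théorème 1 (π₀ Diff⁺(S³) = 0, i.e. π₀ Diff(S³) ≅ π₀ O(4) ≅ ℤ/2; reproved by Hatcher
1983, Diff(S³) ≃ O(4)) in the orientation-free PIGEONHOLE form that FibrationRecognition,
OneHandleCancellation and both assemblies already carry verbatim as an antecedent: among any three
self-diffeomorphisms φ ψ χ of the round S³, two are joined by a jointly smooth path F : ℝ × S³ → S³
of smooth self-embeddings (= diffeomorphisms, S³ being closed and connected) with F 0 and F 1 the
two maps. Follows from the tree named fact
`Literature.Topology.FourManifolds.cerf_pi0Diff_sphere_three` (RadialExtension.lean: every φ is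
diffeotopic to id or to a fixed hyperplane reflection) by pigeonhole plus composition/reversal of
diffeotopies (flat reparametrisation near the ends, constant extension to t ∉ [0,1]); closes by that
short argument once the fact is discharged. Sources: CerfDiffeoSphere1968, Hatcher1983. -/
@[route_item "route-SmoothPoincare4-OneHandleSplitting", crux]
def CerfTwoComponents : Prop :=
  ∀ (φ ψ χ : (Metric.sphere (0 : EuclideanSpace ℝ (Fin 4)) 1) ≃ₘ⟮𝓡 3, 𝓡 3⟯ (Metric.sphere (0 : EuclideanSpace ℝ (Fin 4)) 1)), (∃ F : ℝ → (Metric.sphere (0 : EuclideanSpace ℝ (Fin 4)) 1) → (Metric.sphere (0 : EuclideanSpace ℝ (Fin 4)) 1), ContMDiff (𝓘(ℝ, ℝ).prod (𝓡 3)) (𝓡 3) ∞ (Function.uncurry F) ∧ (∀ t : ℝ, Manifold.IsSmoothEmbedding (𝓡 3) (𝓡 3) ∞ (F t)) ∧ F 0 = ⇑φ ∧ F 1 = ⇑ψ) ∨ (∃ F : ℝ → (Metric.sphere (0 : EuclideanSpace ℝ (Fin 4)) 1) → (Metric.sphere (0 : EuclideanSpace ℝ (Fin 4)) 1), ContMDiff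 (𝓘(ℝ, ℝ).prod (𝓡 3)) (𝓡 3) ∞ (Function.uncurry F) ∧ (∀ t : ℝ, Manifold.IsSmoothEmbedding (𝓡 3) (𝓡 3) ∞ (F t)) ∧ F 0 = ⇑ψ ∧ F 1 = ⇑χ) ∨ (∃ F : ℝ → (Metric.sphere (0 : EuclideanSpace ℝ (Fin 4)) 1) → (Metric.sphere (0 : EuclideanSpace ℝ (Fin 4)) 1), ContMDiff (𝓘(ℝ, ℝ).prod (𝓡 3)) (𝓡 3) ∞ (Function.uncurry F) ∧ (∀ t : ℝ, Manifold.IsSmoothEmbedding (𝓡 3) (𝓡 3) ∞ (F t)) ∧ F 0 = ⇑φ ∧ F 1 = ⇑χ)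

/-- item stmt-SmoothPoincare4-10797 · support · rank 8 · open · by planner
[support] APEX INPUT (published theorem restated as a route hypothesis; NOT a prover target; the
ENGINE of the pinched rung, whose research risk is carried by crux FibrationRecognition: May-2026
preprint, δ(4,κ) ineffective). Huang–Huang–Wang–Zhu 2026, arXiv:2605.24380, Main Theorem 1 (p. 3)
with the smooth-fibre-bundle statement (p. 14), specialised to n = 4 and b₁ = 1 — verbatim the third
antecedent of FibrationRecognition / Assembly: for every κ > 0 there is δ = δ(4, κ) > 0 such that
every closed smooth 4-manifold P ≃ₕ S¹×S³ with a C^∞ metric g, diam(P, g) ≤ 1 (riemannianEDist),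
sec_g ≥ −κ (Gram form) and Ric_g ≥ −δ·g admits a C^∞ submersion f : P → S¹ with connected fibres
(diam ≤ 1 turns diam²·sec ≥ −κ, diam²·Ric ≥ −δ into the pointwise bounds; b₁(P) = 1 makes the base
torus T^{b₁} = S¹; a submersion of closed P onto S¹ with connected fibres is the fibre bundle of the
paper by Ehresmann). To be vendored as a Literature named fact (Geometry/Riemannian); closes by one
line then. Sources: arXiv:2605.24380, CheegerColding1997, Colding1997. -/
@[route_item "route-SmoothPoincare4-OneHandleSplitting", crux]
def CircleFibration : Prop :=
  ∀ κ : ℝ, 0 < κ → ∃ δ : ℝ, 0 < δ ∧ ∀ (P : Type) [TopologicalSpace P] [T2Space P] [SecondCountableTopology P] [ChartedSpace (EuclideanSpace ℝ (Fin 4)) P] [IsManifold (𝓡 4) ∞ P] [CompactSpace P], P ≃ₕ ((Metric.sphere (0 : EuclideanSpace ℝ (Fin 2)) 1) × (Metric.sphere (0 : EuclideanSpace ℝ (Fin 4)) 1)) → ∀ (g : Bundle.ContMDiffRiemannianMetric (𝓡 4) ∞ (EuclideanSpace ℝ (Fin 4)) (TangentSpace (𝓡 4) : P → Type _)) [(Literature.Geometry.Lorentzian.PseudoRiemannianMetric.ofRiemannian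 g).HasLeviCivita], (open Bundle in letI : Bundle.RiemannianBundle (fun x : P ↦ TangentSpace (𝓡 4) x) := ⟨g.toContinuousRiemannianMetric.toRiemannianMetric⟩; ∀ x y : P, Manifold.riemannianEDist (𝓡 4) x y ≤ 1) → (∀ (x : P) (X Y : TangentSpace (𝓡 4) x), -κ * (g.inner x X X * g.inner x Y Y - g.inner x X Y ^ 2) ≤ (Literature.Geometry.Lorentzian.PseudoRiemannianMetric.ofRiemannian g).curvatureForm (Literature.Geometry.Lorentzian.PseudoRiemannianMetric.ofRiemannian g).leviCivita x X Y Y X) → (∀ (x : P) (w : TangentSpace (𝓡 4) x), -δ * g.inner x w w ≤ (Literature.Geometry.Lorentzian.PseudoRiemannianMetric.ofRiemannian g).ricci x w w) → ∃ f : P → (Metric.sphere (0 : EuclideanSpace ℝ (Fin 2)) 1), ContMDiff (𝓡 4) (𝓡 1) ∞ f ∧ (∀ x : P, Function.Surjective (mfderiv (𝓡 4) (𝓡 1) f x)) ∧ ∀ θ : (Metric.sphere (0 : EuclideanSpace ℝ (Fin 2)) 1), IsConnected (f ⁻¹' {θ})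

/-- item stmt-SmoothPoincare4-8546 · support · rank 8 · open · by planner
[support] APEX INPUT (cone discipline of this route, rev 1): a published theorem restated VERBATIM
as a route hypothesis item, inlined rather than imported because importing the Literature file that
names it would put an unproved named fact into the route's import cone and freeze staffing (Phase C
guardrail); it is NOT a target for provers (it closes the day the corresponding Literature fact is
discharged, by a one-line `theorem … := <fact>_holds`), and it enters the assemblies as an explicit
antecedent so that closing every non-apex item proves `apex inputs ⇒ SmoothPoincare4` honestly. THIS
ITEM: Budney–Gabai 2019 (arXiv:1912.09029) Theorem 3.13, p. 22 read verbatim: 'The group Diff(S¹×Sⁿ)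
acts transitively on the non-separating n-spheres in S¹×Sⁿ. Moreover, every non-separating n-sphere
is the fiber of a fiber bundle S¹×Sⁿ → S¹' (proof there: drill S¹×{*} meeting the sphere once,
reduce to reducing balls in S¹×Bⁿ, Thm 3.12, via Cerf's half-disc fibering lemma). Transcribed at n
= 3 for spheres given as smooth embeddings e : S³ → S¹×S³ of the ROUND S³ (a sub-class of BG's
embedded 3-spheres, so implied by the printed statement) with non-separating ⇔ the complement of the
image is -/
@[route_item "route-SmoothPoincare4-OneHandleSplitting", crux]
def NonSeparatingTransitivity : Prop :=
  ∀ (e₁ e₂ : (Metric.sphere (0 : EuclideanSpace ℝ (Fin 4)) 1) → ((Metric.sphere (0 : EuclideanSpace ℝ (Fin 2)) 1) × (Metric.sphere (0 : EuclideanSpace ℝ (Fin 4)) 1))), Manifold.IsSmoothEmbedding (𝓡 3) ((𝓡 1).prod (𝓡 3)) ∞ e₁ → Manifold.IsSmoothEmbedding (𝓡 3) ((𝓡 1).prod (𝓡 3)) ∞ e₂ → IsConnected (Set.range e₁)ᶜ → IsConnected (Set.range e₂)ᶜ → ∃ χ : ((Metric.sphere (0 : EuclideanSpace ℝ (Fin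 2)) 1) × (Metric.sphere (0 : EuclideanSpace ℝ (Fin 4)) 1)) ≃ₘ⟮(𝓡 1).prod (𝓡 3), (𝓡 1).prod (𝓡 3)⟯ ((Metric.sphere (0 : EuclideanSpace ℝ (Fin 2)) 1) × (Metric.sphere (0 : EuclideanSpace ℝ (Fin 4)) 1)), χ '' Set.range e₁ = Set.range e₂

/-- item stmt-SmoothPoincare4-8121 · support · rank 9 · open · by planner
sources: BudneyGabai2019, CerfDiffeoSphere1968, LaudenbachPoenaru1972, KervaireMilnorAnnals1963, Kosinski1993
[support] ONE 1-HANDLE NEVER DISSOLVES A FAKE 4-SPHERE (card rung L1, k = 1): for every closed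
smooth M ≃ₕ S⁴ and every relational connected sum P = M # (S¹×S³), P ≅ S¹×S³ ⇒ M ≅ S⁴. Proof in
print modulo assembly: the fibre {θ}×S³ of the summand (after a Palais isotopy making the summing
disc small) is a non-separating 3-sphere F ⊂ P with P ∖ νF ≅ M°° (M minus two balls); Diff(S¹×S³) is
transitive on non-separating 3-spheres (BudneyGabai2019 Thm 3.13, p. 22 read), so the image of F has
complement S³×I, whence M°° ≅ S³×I and M = M°° ∪ 2B⁴ ≅ S⁴ (Γ₄ = 0, tree fact
`Literature.Topology.FourManifolds.cerf_twistedSphere_four`). Alternative elementary proof: realise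
Aut(F₁) = ℤ/2 by a diffeo, isotope the core circle, surger (both framings give S⁴ on S¹×S³ and M on
P). Mathematically provable now; formally long (relational gluing, both orientations of the summand
occur — harmless since S¹×S³ admits an orientation-reversing diffeomorphism). [difficulty: L] -/
@[route_item "route-SmoothPoincare4-OneHandleSplitting", crux]
def OneHandleCancellation : Prop :=
  (∀ (e₁ e₂ : (Metric.sphere (0 : EuclideanSpace ℝ (Fin 4)) 1) → ((Metric.sphere (0 : EuclideanSpace ℝ (Fin 2)) 1) × (Metric.sphere (0 : EuclideanSpace ℝ (Fin 4)) 1))), Manifold.IsSmoothEmbedding (𝓡 3) ((𝓡 1).prod (𝓡 3)) ∞ e₁ → Manifold.IsSmoothEmbedding (𝓡 3) ((𝓡 1).prod (𝓡 3)) ∞ e₂ → IsConnected (Set.range e₁)ᶜ → IsConnected (Set.range e₂)ᶜ → ∃ χ : ((Metric.sphere (0 : EuclideanSpace ℝ (Fin 2)) 1) × (Metric.sphere (0 : EuclideanSpace ℝ (Fin 4)) 1)) ≃ₘ⟮(𝓡 1).prod (𝓡 3), (𝓡 1).prod (𝓡 3)⟯ ((Metric.sphere (0 : EuclideanSpace ℝ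 (Fin 2)) 1) × (Metric.sphere (0 : EuclideanSpace ℝ (Fin 4)) 1)), χ '' Set.range e₁ = Set.range e₂) → (∀ (φ ψ χ : (Metric.sphere (0 : EuclideanSpace ℝ (Fin 4)) 1) ≃ₘ⟮𝓡 3, 𝓡 3⟯ (Metric.sphere (0 : EuclideanSpace ℝ (Fin 4)) 1)), (∃ F : ℝ → (Metric.sphere (0 : EuclideanSpace ℝ (Fin 4)) 1) → (Metric.sphere (0 : EuclideanSpace ℝ (Fin 4)) 1), ContMDiff (𝓘(ℝ, ℝ).prod (𝓡 3)) (𝓡 3) ∞ (Function.uncurry F) ∧ (∀ t : ℝ, Manifold.IsSmoothEmbedding (𝓡 3) (𝓡 3) ∞ (F t)) ∧ F 0 = ⇑φ ∧ F 1 = ⇑ψ) ∨ (∃ F : ℝ → (Metric.sphere (0 : EuclideanSpace ℝ (Fin 4)) 1) → (Metric.sphere (0 : EuclideanSpace ℝ (Fin 4)) 1), ContMDiff (𝓘(ℝ, ℝ).prod (𝓡 3)) (𝓡 3) ∞ (Function.uncurry F) ∧ (∀ t : ℝ, Manifold.IsSmoothEmbedding (𝓡 3) (𝓡 3) ∞ (F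 t)) ∧ F 0 = ⇑ψ ∧ F 1 = ⇑χ) ∨ (∃ F : ℝ → (Metric.sphere (0 : EuclideanSpace ℝ (Fin 4)) 1) → (Metric.sphere (0 : EuclideanSpace ℝ (Fin 4)) 1), ContMDiff (𝓘(ℝ, ℝ).prod (𝓡 3)) (𝓡 3) ∞ (Function.uncurry F) ∧ (∀ t : ℝ, Manifold.IsSmoothEmbedding (𝓡 3) (𝓡 3) ∞ (F t)) ∧ F 0 = ⇑φ ∧ F 1 = ⇑χ)) → ∀ (M : Type) [TopologicalSpace M] [T2Space M] [SecondCountableTopology M] [ChartedSpace (EuclideanSpace ℝ (Fin 4)) M] [IsManifold (𝓡 4) ∞ M] [CompactSpace M], M ≃ₕ Metric.sphere (0 : EuclideanSpace ℝ (Fin 5)) 1 → ∀ (P : Type) [TopologicalSpace P] [T2Space P] [SecondCountableTopology P] [ChartedSpace (EuclideanSpace ℝ (Fin 4)) P] [IsManifold (𝓡 4) ∞ P] [CompactSpace P], Literature.Topology.FourManifolds.IsConnectedSum (𝓡 4) (𝓡 4) ((𝓡 1).prod (𝓡 3)) M ((Metric.sphere (0 : EuclideanSpace ℝ (Fin 2))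 1) × (Metric.sphere (0 : EuclideanSpace ℝ (Fin 4)) 1)) P → Nonempty (P ≃ₘ⟮𝓡 4, (𝓡 1).prod (𝓡 3)⟯ ((Metric.sphere (0 : EuclideanSpace ℝ (Fin 2)) 1) × (Metric.sphere (0 : EuclideanSpace ℝ (Fin 4)) 1))) → Nonempty (M ≃ₘ⟮𝓡 4, 𝓡 4⟯ Metric.sphere (0 : EuclideanSpace ℝ (Fin 5)) 1)

/-- item stmt-SmoothPoincare4-8122 · support · rank 9 · open · by planner
sources: KervaireMilnorAnnals1963, HatcherAT2002, Kosinski1993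
[support] bridge from the Σ-family to the recognisers' class: every relational connected sum P of a
closed smooth M ≃ₕ S⁴ with S¹×S³ is homotopy equivalent to S¹×S³ (M minus a disc is contractible
with boundary S³, hence ≃ B⁴ rel ∂ by Whitehead; glue). Folklore; needed because
FibrationRecognition / AlmostSplittingRigidity / SplittingRecognition are stated over all smooth
homotopy S¹×S³'s (their natural generality), while existence is stated over the Σ-family (equivalent
to SPC4). [difficulty: M] -/
@[route_item "route-SmoothPoincare4-OneHandleSplitting", crux]
def StabilisationHomotopyType : Prop :=
  ∀ (M : Type) [TopologicalSpace M] [T2Space M] [SecondCountableTopology M] [ChartedSpace (EuclideanSpace ℝ (Fin 4)) M] [IsManifold (𝓡 4) ∞ M] [CompactSpace M], M ≃ₕ Metric.sphere (0 : EuclideanSpace ℝ (Fin 5)) 1 → ∀ (P : Type) [TopologicalSpace P] [T2Space P] [SecondCountableTopology P] [ChartedSpace (EuclideanSpace ℝ (Fin 4)) P] [IsManifold (𝓡 4) ∞ P] [CompactSpace P], Literature.Topology.FourManifolds.IsConnectedSum (𝓡 4) (𝓡 4) ((𝓡 1).prod (𝓡 3)) M ((Metric.sphere (0 : EuclideanSpace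 ℝ (Fin 2)) 1) × (Metric.sphere (0 : EuclideanSpace ℝ (Fin 4)) 1)) P → Nonempty (P ≃ₕ ((Metric.sphere (0 : EuclideanSpace ℝ (Fin 2)) 1) × (Metric.sphere (0 : EuclideanSpace ℝ (Fin 4)) 1)))

/-- item stmt-SmoothPoincare4-8123 · support · rank 9 · open · by planner
sources: doi:10.4310/jdg/1214430220, Hamilton1986, CerfDiffeoSphere1968, Hatcher1983
[support] the ε = 0 rung (card rung L2, KNOWN): a closed smooth 4-manifold P ≃ₕ S¹×S³ with a C^∞
metric of Ric ≥ 0 is diffeomorphic to S¹×S³. Proof in print: universal cover splits isometrically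
ℝ^k × N with N compact (doi:10.4310/jdg/1214430220 = Cheeger–Gromoll 1971 Thm 3), π₁ = ℤ forces k =
1 and N simply connected, N ≅ S³ (Hamilton1986 Thm 1.2, no Perelman needed), the deck generator is
(translation, isometry φ of N), so P is the mapping torus of an orientation-preserving φ, ≅ S³×S¹ by
Cerf. Consistency anchor of both recognisers (their ε → 0 limit) and the card's headline "Ric ≥ 0 on
Σ#(S¹×S³) characterises S⁴"; to be vendored as Literature facts. [difficulty: XL] -/
@[route_item "route-SmoothPoincare4-OneHandleSplitting"]
def SplittingRecognition : Prop :=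
  ∀ (P : Type) [TopologicalSpace P] [T2Space P] [SecondCountableTopology P] [ChartedSpace (EuclideanSpace ℝ (Fin 4)) P] [IsManifold (𝓡 4) ∞ P] [CompactSpace P], P ≃ₕ ((Metric.sphere (0 : EuclideanSpace ℝ (Fin 2)) 1) × (Metric.sphere (0 : EuclideanSpace ℝ (Fin 4)) 1)) → ∀ (g : Bundle.ContMDiffRiemannianMetric (𝓡 4) ∞ (EuclideanSpace ℝ (Fin 4)) (TangentSpace (𝓡 4) : P → Type _)) [(Literature.Geometry.Lorentzian.PseudoRiemannianMetric.ofRiemannian g).HasLeviCivita], (∀ (x : P) (w : TangentSpace (𝓡 4) x), 0 ≤ (Literature.Geometry.Lorentzian.PseudoRiemannianMetric.ofRiemannian g).ricci x w w) → Nonempty (P ≃ₘ⟮𝓡 4, (𝓡 1).prod (𝓡 3)⟯ ((Metric.sphere (0 : EuclideanSpace ℝ (Fin 2)) 1) × (Metric.sphere (0 : EuclideanSpace ℝ (Fin 4)) 1)))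

/-- item stmt-SmoothPoincare4-8124 · support · rank 9 · open · by planner
sources: Kirby1997, HatcherAT2002
[support] glue of the volume rung: AlmostSplittingRigidity → StabilisationHomotopyType →
OneHandleCancellation → AlmostNonnegRicciStabilisation → SmoothPoincare4. Pure logic plus the
in-tree compactness theorem
`Literature.Topology.FourManifolds.compactSpace_of_homotopyEquiv_sphere_four_holds`; PROVED in the
planner's Sketch.lean (12 lines: unfold the summit, get v from existence, ε from rigidity, P and g
from existence, P ≃ₕ S¹×S³ from the bridge, P ≅ S¹×S³ from rigidity, M ≅ S⁴ from cancellation).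
[difficulty: provable-now] -/
@[route_item "route-SmoothPoincare4-OneHandleSplitting"]
def VolumeRungAssembly : Prop :=
  (∀ (e₁ e₂ : (Metric.sphere (0 : EuclideanSpace ℝ (Fin 4)) 1) → ((Metric.sphere (0 : EuclideanSpace ℝ (Fin 2)) 1) × (Metric.sphere (0 : EuclideanSpace ℝ (Fin 4)) 1))), Manifold.IsSmoothEmbedding (𝓡 3) ((𝓡 1).prod (𝓡 3)) ∞ e₁ → Manifold.IsSmoothEmbedding (𝓡 3) ((𝓡 1).prod (𝓡 3)) ∞ e₂ → IsConnected (Set.range e₁)ᶜ → IsConnected (Set.range e₂)ᶜ → ∃ χ : ((Metric.sphere (0 : EuclideanSpace ℝ (Fin 2)) 1) × (Metric.sphere (0 : EuclideanSpace ℝ (Fin 4)) 1)) ≃ₘ⟮(𝓡 1).prod (𝓡 3), (𝓡 1).prod (𝓡 3)⟯ ((Metric.sphere (0 : EuclideanSpace ℝ (Fin 2)) 1) × (Metric.sphere (0 : EuclideanSpace ℝ (Fin 4)) 1)), χ '' Set.range e₁ = Set.range e₂) → (∀ (φ ψ χ : (Metric.sphere (0 : EuclideanSpace ℝ (Fin 4))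 1) ≃ₘ⟮𝓡 3, 𝓡 3⟯ (Metric.sphere (0 : EuclideanSpace ℝ (Fin 4)) 1)), (∃ F : ℝ → (Metric.sphere (0 : EuclideanSpace ℝ (Fin 4)) 1) → (Metric.sphere (0 : EuclideanSpace ℝ (Fin 4)) 1), ContMDiff (𝓘(ℝ, ℝ).prod (𝓡 3)) (𝓡 3) ∞ (Function.uncurry F) ∧ (∀ t : ℝ, Manifold.IsSmoothEmbedding (𝓡 3) (𝓡 3) ∞ (F t)) ∧ F 0 = ⇑φ ∧ F 1 = ⇑ψ) ∨ (∃ F : ℝ → (Metric.sphere (0 : EuclideanSpace ℝ (Fin 4)) 1) → (Metric.sphere (0 : EuclideanSpace ℝ (Fin 4)) 1), ContMDiff (𝓘(ℝ, ℝ).prod (𝓡 3)) (𝓡 3) ∞ (Function.uncurry F) ∧ (∀ t : ℝ, Manifold.IsSmoothEmbedding (𝓡 3) (𝓡 3) ∞ (F t)) ∧ F 0 = ⇑ψ ∧ F 1 = ⇑χ) ∨ (∃ F : ℝ → (Metric.sphere (0 : EuclideanSpace ℝ (Fin 4)) 1) → (Metric.sphere (0 : EuclideanSpace ℝ (Fin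 4)) 1), ContMDiff (𝓘(ℝ, ℝ).prod (𝓡 3)) (𝓡 3) ∞ (Function.uncurry F) ∧ (∀ t : ℝ, Manifold.IsSmoothEmbedding (𝓡 3) (𝓡 3) ∞ (F t)) ∧ F 0 = ⇑φ ∧ F 1 = ⇑χ)) → AlmostSplittingRigidity → StabilisationHomotopyType → OneHandleCancellation → AlmostNonnegRicciStabilisation → SmoothPoincare4

/-- item stmt-SmoothPoincare4-8620 · support · rank 9 · open · by planner
[support] needs-fact: Literature.Topology.FourManifolds.IsConnectedSum.compactSpace — this item is
that named fact (ConnectedSum.lean, Kervaire–Milnor 1963 §2 / Kosinski 1993 VI.1: a connected sum of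
compact manifolds is compact; P is the union of the images of M ∖ i₁(ball 0 2⁻¹) and N ∖ i₂(ball 0
2⁻¹)) SPECIALISED to the route's setting P = M # (S¹×S³), M a closed smooth 4-manifold: every
relational connected sum P of a compact M with S¹×S³ is compact. Filed by the route-repair planner
(2026-08-15) as the tier-0 marker of the ONE unproved named fact that rides on a load-bearing import
of this route (IsConnectedSum is used by 4 decls; no decl uses the fact itself because each binds
[CompactSpace P] — once this is proved those binders are redundant). Size S; closes by one line from
`IsConnectedSum.compactSpace_holds` when the Literature fact is discharged, or directly (compactness
of a finite union of compact images). The other 10 unproved facts in the cone (SPC4Wave0: Freedman,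
Perelman ×2, Newman–Connell, Milnor ×2, Moise ×2, exotic ℝ⁴, nonemptyDiffeomorphSphere_of_mem) enter
only through the gate-hard-wired `import Summits.SmoothPoincare4.Statement`; no decl of this route
names t -/
@[route_item "route-SmoothPoincare4-OneHandleSplitting"]
def StabilisationCompact : Prop :=
  ∀ (M : Type) [TopologicalSpace M] [T2Space M] [SecondCountableTopology M] [ChartedSpace (EuclideanSpace ℝ (Fin 4)) M] [IsManifold (𝓡 4) ∞ M] [CompactSpace M] (P : Type) [TopologicalSpace P] [T2Space P] [SecondCountableTopology P] [ChartedSpace (EuclideanSpace ℝ (Fin 4)) P] [IsManifold (𝓡 4) ∞ P], Literature.Topology.FourManifolds.IsConnectedSum (𝓡 4) (𝓡 4) ((𝓡 1).prod (𝓡 3)) M ((Metric.sphere (0 : EuclideanSpace ℝ (Fin 2)) 1) × (Metric.sphere (0 : EuclideanSpace ℝ (Fin 4)) 1)) P → CompactSpace P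

/-- item stmt-SmoothPoincare4-8125 · assembly · rank 1 · open · by planner
sources: Kirby1997, arXiv:2605.24380, BudneyGabai2019
[assembly] FibrationRecognition → StabilisationHomotopyType → OneHandleCancellation →
PinchedStabilisation → SmoothPoincare4. -/
@[route_item "route-SmoothPoincare4-OneHandleSplitting"]
def Assembly : Prop :=
  (∀ (F : Type) [TopologicalSpace F] [T2Space F] [SecondCountableTopology F] [ChartedSpace (EuclideanSpace ℝ (Fin 3)) F] [IsManifold (𝓡 3) ∞ F] [SimplyConnectedSpace F] [CompactSpace F], Nonempty (F ≃ₘ⟮𝓡 3, 𝓡 3⟯ (Metric.sphere (0 : EuclideanSpace ℝ (Fin 4)) 1))) → (∀ (φ ψ χ : (Metric.sphere (0 : EuclideanSpace ℝ (Fin 4)) 1) ≃ₘ⟮𝓡 3, 𝓡 3⟯ (Metric.sphere (0 : EuclideanSpace ℝ (Fin 4)) 1)), (∃ F : ℝ → (Metric.sphere (0 : EuclideanSpace ℝ (Fin 4)) 1) → (Metric.sphere (0 : EuclideanSpace ℝ (Fin 4)) 1), ContMDiff (𝓘(ℝ, ℝ).prod (𝓡 3)) (𝓡 3) ∞ (Function.uncurry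 F) ∧ (∀ t : ℝ, Manifold.IsSmoothEmbedding (𝓡 3) (𝓡 3) ∞ (F t)) ∧ F 0 = ⇑φ ∧ F 1 = ⇑ψ) ∨ (∃ F : ℝ → (Metric.sphere (0 : EuclideanSpace ℝ (Fin 4)) 1) → (Metric.sphere (0 : EuclideanSpace ℝ (Fin 4)) 1), ContMDiff (𝓘(ℝ, ℝ).prod (𝓡 3)) (𝓡 3) ∞ (Function.uncurry F) ∧ (∀ t : ℝ, Manifold.IsSmoothEmbedding (𝓡 3) (𝓡 3) ∞ (F t)) ∧ F 0 = ⇑ψ ∧ F 1 = ⇑χ) ∨ (∃ F : ℝ → (Metric.sphere (0 : EuclideanSpace ℝ (Fin 4)) 1) → (Metric.sphere (0 : EuclideanSpace ℝ (Fin 4)) 1), ContMDiff (𝓘(ℝ, ℝ).prod (𝓡 3)) (𝓡 3) ∞ (Function.uncurry F) ∧ (∀ t : ℝ, Manifold.IsSmoothEmbedding (𝓡 3) (𝓡 3) ∞ (F t)) ∧ F 0 = ⇑φ ∧ F 1 = ⇑χ)) → (∀ κ : ℝ, 0 < κ → ∃ δ : ℝ, 0 < δ ∧ ∀ (P : Type)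 [TopologicalSpace P] [T2Space P] [SecondCountableTopology P] [ChartedSpace (EuclideanSpace ℝ (Fin 4)) P] [IsManifold (𝓡 4) ∞ P] [CompactSpace P], P ≃ₕ ((Metric.sphere (0 : EuclideanSpace ℝ (Fin 2)) 1) × (Metric.sphere (0 : EuclideanSpace ℝ (Fin 4)) 1)) → ∀ (g : Bundle.ContMDiffRiemannianMetric (𝓡 4) ∞ (EuclideanSpace ℝ (Fin 4)) (TangentSpace (𝓡 4) : P → Type _)) [(Literature.Geometry.Lorentzian.PseudoRiemannianMetric.ofRiemannian g).HasLeviCivita], (open Bundle in letI : Bundle.RiemannianBundle (fun x : P ↦ TangentSpace (𝓡 4) x) := ⟨g.toContinuousRiemannianMetric.toRiemannianMetric⟩; ∀ x y : P, Manifold.riemannianEDist (𝓡 4) x y ≤ 1) → (∀ (x : P) (X Y : TangentSpace (𝓡 4) x), -κ * (g.inner x X X * g.inner x Y Y - g.inner x X Y ^ 2) ≤ (Literature.Geometry.Lorentzian.PseudoRiemannianMetric.ofRiemannian g).curvatureForm (Literature.Geometry.Lorentzian.PseudoRiemannianMetric.ofRiemannian g).leviCivita x X Y Y X) → (∀ (x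 : P) (w : TangentSpace (𝓡 4) x), -δ * g.inner x w w ≤ (Literature.Geometry.Lorentzian.PseudoRiemannianMetric.ofRiemannian g).ricci x w w) → ∃ f : P → (Metric.sphere (0 : EuclideanSpace ℝ (Fin 2)) 1), ContMDiff (𝓡 4) (𝓡 1) ∞ f ∧ (∀ x : P, Function.Surjective (mfderiv (𝓡 4) (𝓡 1) f x)) ∧ ∀ θ : (Metric.sphere (0 : EuclideanSpace ℝ (Fin 2)) 1), IsConnected (f ⁻¹' {θ})) → (∀ (e₁ e₂ : (Metric.sphere (0 : EuclideanSpace ℝ (Fin 4)) 1) → ((Metric.sphere (0 : EuclideanSpace ℝ (Fin 2)) 1) × (Metric.sphere (0 : EuclideanSpace ℝ (Fin 4)) 1))), Manifold.IsSmoothEmbedding (𝓡 3) ((𝓡 1).prod (𝓡 3)) ∞ e₁ → Manifold.IsSmoothEmbedding (𝓡 3) ((𝓡 1).prod (𝓡 3)) ∞ e₂ → IsConnected (Set.range e₁)ᶜ → IsConnected (Set.range e₂)ᶜ → ∃ χ : ((Metric.sphere (0 : EuclideanSpace ℝ (Fin 2)) 1) × (Metric.sphere (0 : EuclideanSpace ℝ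 (Fin 4)) 1)) ≃ₘ⟮(𝓡 1).prod (𝓡 3), (𝓡 1).prod (𝓡 3)⟯ ((Metric.sphere (0 : EuclideanSpace ℝ (Fin 2)) 1) × (Metric.sphere (0 : EuclideanSpace ℝ (Fin 4)) 1)), χ '' Set.range e₁ = Set.range e₂) → FibrationRecognition → StabilisationHomotopyType → OneHandleCancellation → PinchedStabilisation → SmoothPoincare4

/-! D-0027 §2.1 — DECIDING THEOREM (planner-authored via `route open/edit --closes-file`; by planner-rbadge-SmoothPoincare4-OneHandleSplitt-7941f49d-g4-0 2026-08-15T16:52:08Z):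
its hypotheses are this route's items and its conclusion the sub-problem Statement (glue_lint), and it elaborates with this file. -/

@[closes "route-SmoothPoincare4-OneHandleSplitting"] theorem closes (h_FibrationRecognition : FibrationRecognition) (h_PinchedStabilisation : PinchedStabilisation)
    (h_NonSeparatingTransitivity : NonSeparatingTransitivity) (h_OneHandleCancellation : OneHandleCancellation)
    (h_StabilisationHomotopyType : StabilisationHomotopyType) (h_PoincareThreeSphere : PoincareThreeSphere)
    (h_CerfTwoComponents : CerfTwoComponents) (h_CircleFibration : CircleFibration) :
    _root_.SmoothPoincare4 := by
  -- SPC4 unfolds to: every Hausdorff second-countable C^∞ 4-manifold M ≃ₕ S⁴ is diffeomorphic to S⁴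
  unfold _root_.SmoothPoincare4 Literature.SPC4.SmoothPoincareConjectureFour
    ContinuousMap.HomotopyEquiv.NonemptyDiffeomorphSphere
  intro M _ _ _ _ _ e
  -- M is closed (H₄ ≠ 0; in-tree theorem, Hatcher 3.29 + 2.14)
  haveI : CompactSpace M :=
    Literature.Topology.FourManifolds.compactSpace_of_homotopyEquiv_sphere_four_holds M e
  -- κ from the thesis X (existence half), δ = δ(4, κ) from the recogniser, then P = M # (S¹×S³) and g at that δ
  obtain ⟨κ, hκ, hκ'⟩ := h_PinchedStabilisation M e
  obtain ⟨δ, hδ, hrec⟩ :=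
    h_FibrationRecognition h_PoincareThreeSphere h_CerfTwoComponents h_CircleFibration κ hκ
  obtain ⟨P, _, _, _, _, _, _, hsum, g, hLC, hdiam, hsec, hric⟩ := hκ' δ hδ
  -- P ≃ₕ S¹×S³ (bridge), hence P ≅ S¹×S³ (fibration recognition), hence M ≅ S⁴ (one 1-handle never dissolves a fake S⁴)
  obtain ⟨e'⟩ := h_StabilisationHomotopyType M e P hsum
  haveI := hLC
  exact h_OneHandleCancellation h_NonSeparatingTransitivity h_CerfTwoComponents M e P hsum
    (hrec P e' g hdiam hsec hric)

end Summit.SmoothPoincare4.SmoothPoincare4.Theses.OneHandleSplitting
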